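import Summits.Parity.GeneralizedHardyLittlewood.Theorems.BeyondDiagonalBeatsQuarter.OffDiagDualCostBessel
import HarnessLib

/-!
# Route `PrimeLevelFamEdge`, crux K_B (stmt-Parity-20343), line `diagonal_kernel_split` rev 4, plan Ω,
# lemma L2c (derivative costs), primitive 3: **all derivatives of `t ↦ J_n(b√t)`: cost `(1+Z)/t` per derivative**

OMEGA-BLUEPRINT §2–§3 L2: in the profile `g(t) ∝ t^{−1/2} W(at) J₁(b√t)` (`t = y₁y₂`, `b√t = Z`) each
`t`-derivative of the Bessel factor costs `≍ (1+Z)/t`. Here, for every `n, k ∈ ℕ`, `b ∈ ℝ`, `t > 0`: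

* `iteratedDeriv_const_mul_rpow` — on `t > 0`, `(dⁱ/dtⁱ)(b·tᵖ) = b·c(p,i)·t^{p−i}`, `c(p,i) = ∏_{m<i}(p − m)`;
  `abs_rpowCoeff_half_le` — `|c(1/2,i)| ≤ i!`;
* **`norm_iteratedDeriv_besselJ_sqrt_le`** —
  `‖(dᵏ/dtᵏ) J_n(b√t)‖ ≤ k! · (k(1 + |b|√t)/t)ᵏ`
  (Faà di Bruno, Mathlib's `norm_iteratedFDerivWithin_comp_le` on `(0,∞)`, with `|J_n^{(i)}| ≤ 1` from primitive 1
  and `|(dⁱ/dtⁱ)(b√t)| ≤ |b|·i!·√t·t^{−i} ≤ (k(1+|b|√t)/t)ⁱ`).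

Folklore real analysis, PROVED; theorems only. Helper; closes nothing.
«The programme SEARCHES and TYPES; no claim about Landau–Siegel zeros, Theorems 1–2 of arXiv:2211.02515 or
a repaired Margin232 until a kernel theorem says so.»
-/

noncomputable section

open Real Set
open scoped Topology ContDiff Nat

namespace Summit.Parity.GeneralizedHardyLittlewood.Theorems.BeyondDiagonalBeatsQuarter.OffDiagPoissonTwisted

open Literature.Analysis.FunctionSpaces

/-! ### Powers `t ↦ b·tᵖ` on `(0,∞)` -/

/-- The falling-factorial coefficient `c(p,i) = ∏_{m<i} (p − m)` of `(dⁱ/dtⁱ) tᵖ = c(p,i) t^{p−i}`, written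
inline as a `Finset.prod`; this lemma is the recursion `c(p,i+1) = c(p,i)·(p − i)`. [folklore] -/
theorem rpowCoeff_succ (p : ℝ) (i : ℕ) :
    ∏ m ∈ Finset.range (i + 1), (p - m) = (∏ m ∈ Finset.range i, (p - m)) * (p - i) :=
  Finset.prod_range_succ _ _

/-- `|c(1/2, i)| ≤ i!`. [folklore] -/
theorem abs_rpowCoeff_half_le (i : ℕ) : |∏ m ∈ Finset.range i, ((1 : ℝ) / 2 - m)| ≤ i ! := by
  induction i with
  | zero => simp
  | succ i ih =>
    rw [Finset.prod_range_succ, abs_mul, Nat.factorial_succ, Nat.cast_mul, mul_comm ((i + 1 : ℕ) : ℝ)]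
    refine mul_le_mul ih ?_ (abs_nonneg _) (by positivity)
    rw [abs_le]
    push_cast
    constructor <;> linarith

/-- **`(dⁱ/dtⁱ)(b·tᵖ) = b·c(p,i)·t^{p−i}` on `t > 0`** (induction, `d/dt tᵖ = p t^{p−1}`, locality of `deriv`).
[folklore] -/
theorem iteratedDeriv_const_mul_rpow (b p : ℝ) (i : ℕ) :
    EqOn (iteratedDeriv i (fun t : ℝ => b * t ^ p))
      (fun t : ℝ => b * (∏ m ∈ Finset.range i, (p - m)) * t ^ (p - i)) (Ioi 0) := by
  induction i with
  | zero => intro t _; simp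
  | succ i ih =>
    intro t ht
    have ht' : 0 < t := mem_Ioi.mp ht
    rw [iteratedDeriv_succ]
    have hev : iteratedDeriv i (fun t : ℝ => b * t ^ p) =ᶠ[𝓝 t]
        fun t : ℝ => b * (∏ m ∈ Finset.range i, (p - m)) * t ^ (p - i) :=
      ih.eventuallyEq_of_mem (Ioi_mem_nhds ht')
    rw [hev.deriv_eq]
    have hd : HasDerivAt (fun t : ℝ => b * (∏ m ∈ Finset.range i, (p - m)) * t ^ (p - i))
        (b * (∏ m ∈ Finset.range i, (p - m)) * ((p - i) * t ^ (p - i - 1))) t :=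
      (Real.hasDerivAt_rpow_const (Or.inl ht'.ne')).const_mul _
    rw [hd.deriv, rpowCoeff_succ]
    push_cast
    ring_nf

/-- The size of `(dⁱ/dtⁱ)(b√t)` for `t > 0`, `1 ≤ i ≤ k`: `‖·‖ ≤ (k(1+|b|√t)/t)ⁱ`. [folklore] -/
theorem norm_iteratedDeriv_const_mul_sqrt_le (b : ℝ) {i k : ℕ} (hi1 : 1 ≤ i) (hik : i ≤ k) {t : ℝ}
    (ht : 0 < t) :
    ‖iteratedDeriv i (fun s : ℝ => b * Real.sqrt s) t‖ ≤ (k * (1 + |b| * Real.sqrt t) / t) ^ i := by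
  have hfun : (fun s : ℝ => b * Real.sqrt s) = fun s : ℝ => b * s ^ ((1 : ℝ) / 2) := by
    funext s; rw [Real.sqrt_eq_rpow]
  rw [hfun, iteratedDeriv_const_mul_rpow b (1 / 2) i (mem_Ioi.mpr ht)]
  dsimp only
  -- `‖b c t^{1/2-i}‖ = |b| |c| √t t^{-i}`
  have hsplit : t ^ ((1 : ℝ) / 2 - i) = Real.sqrt t * (t ^ i)⁻¹ := by
    rw [Real.rpow_sub ht, Real.rpow_natCast, Real.sqrt_eq_rpow, div_eq_mul_inv]
  rw [hsplit, Real.norm_eq_abs, abs_mul, abs_mul, abs_mul, abs_of_nonneg (Real.sqrt_nonneg t),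
    abs_of_pos (inv_pos.mpr (pow_pos ht i))]
  -- `|c| ≤ i! ≤ i^i ≤ k^i`, `|b|√t ≤ (1+|b|√t)^i`
  have hc : |∏ m ∈ Finset.range i, ((1 : ℝ) / 2 - m)| ≤ (k : ℝ) ^ i := by
    refine (abs_rpowCoeff_half_le i).trans ?_
    have h1 : (i ! : ℝ) ≤ (i : ℝ) ^ i := by exact_mod_cast Nat.factorial_le_pow i
    have h2 : (i : ℝ) ^ i ≤ (k : ℝ) ^ i := pow_le_pow_left₀ (Nat.cast_nonneg _) (by exact_mod_cast hik) i
    exact h1.trans h2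
  have hb : |b| * Real.sqrt t ≤ (1 + |b| * Real.sqrt t) ^ i := by
    have h1 : |b| * Real.sqrt t ≤ 1 + |b| * Real.sqrt t := by linarith
    exact h1.trans (le_self_pow₀ (by linarith [mul_nonneg (abs_nonneg b) (Real.sqrt_nonneg t)]) (by omega))
  calc |b| * |∏ m ∈ Finset.range i, ((1 : ℝ) / 2 - m)| * (Real.sqrt t * (t ^ i)⁻¹)
      = |∏ m ∈ Finset.range i, ((1 : ℝ) / 2 - m)| * (|b| * Real.sqrt t) * (t ^ i)⁻¹ := by ring
    _ ≤ (k : ℝ) ^ i * (1 + |b| * Real.sqrt t) ^ i * (t ^ i)⁻¹ := by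
        gcongr
    _ = (k * (1 + |b| * Real.sqrt t) / t) ^ i := by
        rw [div_pow, mul_pow, div_eq_mul_inv]

/-! ### The Bessel factor `t ↦ J_n(b√t)` -/

/-- `t ↦ b√t` is smooth on `(0,∞)`. [folklore] -/
theorem contDiffOn_const_mul_sqrt (b : ℝ) {N : WithTop ℕ∞} :
    ContDiffOn ℝ N (fun s : ℝ => b * Real.sqrt s) (Ioi 0) := fun _ hs =>
  (contDiffAt_const.mul (contDiffAt_sqrt (mem_Ioi.mp hs).ne')).contDiffWithinAt

/-- **All derivatives of the Bessel factor**: for `n, k ∈ ℕ`, `b ∈ ℝ`, `t > 0`,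
`‖(dᵏ/dtᵏ) J_n(b√t)‖ ≤ k! · (k(1 + |b|√t)/t)ᵏ` — each `t`-derivative costs `≲ (1 + Z)/t`, `Z = |b|√t`
(Faà di Bruno with `|J_n^{(i)}| ≤ 1`). [folklore] -/
theorem norm_iteratedDeriv_besselJ_sqrt_le (n k : ℕ) (b : ℝ) {t : ℝ} (ht : 0 < t) :
    ‖iteratedDeriv k (fun s : ℝ => besselJ n (b * Real.sqrt s)) t‖ ≤
      k ! * (k * (1 + |b| * Real.sqrt t) / t) ^ k := by
  have hopen : IsOpen (Ioi (0 : ℝ)) := isOpen_Ioi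
  have hmem : t ∈ Ioi (0 : ℝ) := mem_Ioi.mpr ht
  -- the composite as `g ∘ f`
  have hcomp : (fun s : ℝ => besselJ n (b * Real.sqrt s)) = besselJ n ∘ fun s : ℝ => b * Real.sqrt s := rfl
  have hmain := norm_iteratedFDerivWithin_comp_le (𝕜 := ℝ) (g := besselJ n)
    (f := fun s : ℝ => b * Real.sqrt s) (n := k) (N := (k : ℕ∞)) (s := Ioi (0 : ℝ)) (t := univ) (x := t)
    ((contDiff_besselJ_holds n).contDiffOn) (contDiffOn_const_mul_sqrt b) le_rfl uniqueDiffOn_univ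
    (uniqueDiffOn_Ioi 0) (mapsTo_univ _ _) hmem (C := 1) (D := k * (1 + |b| * Real.sqrt t) / t)
    (fun i _ => by
      rw [iteratedFDerivWithin_univ, norm_iteratedFDeriv_eq_norm_iteratedDeriv]
      exact norm_iteratedDeriv_besselJ_le_one i n _)
    (fun i hi1 hik => by
      rw [norm_iteratedFDerivWithin_eq_norm_iteratedDerivWithin, iteratedDerivWithin_of_isOpen hopen hmem]
      exact norm_iteratedDeriv_const_mul_sqrt_le b hi1 hik ht)
  rw [mul_one] at hmain
  rw [← norm_iteratedFDeriv_eq_norm_iteratedDeriv, ← iteratedFDerivWithin_of_isOpen k hopen hmem, hcomp]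
  exact hmain

end Summit.Parity.GeneralizedHardyLittlewood.Theorems.BeyondDiagonalBeatsQuarter.OffDiagPoissonTwisted
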